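import Summits.Ventures.Crystal3D.Theorems.StickyWulffConstantPolycrystalWulffBoundRungTwinFreeTwoClasses

/-!
# `PolycrystalWulffBound`, line `PolyDensity`: the LP row WALLS ≥ cross-class Euclidean interfaces

Route `StickyWulffConstant` of the venture `Summits/Ventures/Crystal3D`, crux `PolycrystalWulffBound`
(item `stmt-Ventures-19482`), second prover lane (poly-p2, gen 4).  The row «E ≥ F + A» of the middle-band
LP (HOME/poly-p2/MIDDLE-BAND-g4.md §8) in the crux's `let` vocabulary: for an admissible TWIN-FREE texture
and any labelling `cls` of the grains by lattice class, the wall energy dominates the Euclidean area of the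
interfaces between grains of DIFFERENT classes (those pairs are non-co-axial, hence `m = 0`, `c ≥ 1`,
`Dsc 0 = B̄(0,1)`; same-class walls are `≥ 0`):

  `Σ_f Σ_g [cls f ≠ cls g] ι_{B̄(0,1)}(G f, G g)/2 ≤ Σ_f Σ_g [f ≠ g] (c f g/2)·ι_{Dsc(m f g)}(G f, G g)`

(`walls_ge_crossClass`), and the decomposition `En = Σ_f Fr_f + walls` (`en_eq_freeEnergy_add_walls`).
WHAT THIS IS NOT: a rung; F-C1 not moved.
-/

noncomputable section

open scoped BigOperators InnerProductSpace ENNReal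
open MeasureTheory Filter

namespace Summit.Ventures.Crystal3D.Cruxes.PolycrystalWulffBound.PolyDensity

open Summit.Ventures.Crystal3D.Theorems
open Summit.Ventures.Crystal3D.Cruxes.TextureLiminf.TexShadow (per polytope E3)
open Literature.MathematicalPhysics.StatisticalMechanics (perimeter)

/-- **Row «E ≥ F + A»** (wall half): cross-class Euclidean interfaces are dominated by the wall energy. -/
theorem walls_ge_crossClass :
    let Λ : Set (EuclideanSpace ℝ (Fin 3)) := Literature.MathematicalPhysics.StatisticalMechanics.fccStacking 1 (Real.sqrt (2 / 3));
    let Brl : (ℤ → ℤ) → Set (EuclideanSpace ℝ (Fin 3)) := Literature.MathematicalPhysics.StatisticalMechanics.barlowStacking 1 (Real.sqrt (2 / 3));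
    let Ax : EuclideanSpace ℝ (Fin 3) → (EuclideanSpace ℝ (Fin 3) ≃ₗᵢ[ℝ] EuclideanSpace ℝ (Fin 3)) → (EuclideanSpace ℝ (Fin 3) ≃ₗᵢ[ℝ] EuclideanSpace ℝ (Fin 3)) → Prop := fun m A B => ∃ (L : EuclideanSpace ℝ (Fin 3) ≃ₗᵢ[ℝ] EuclideanSpace ℝ (Fin 3)) (s₁ s₂ : EuclideanSpace ℝ (Fin 3)) (σ σ' : ℤ → ℤ), Literature.MathematicalPhysics.StatisticalMechanics.IsHaggSeq σ ∧ Literature.MathematicalPhysics.StatisticalMechanics.IsHaggSeq σ' ∧ L (EuclideanSpace.single (2 : Fin 3) (1 : ℝ)) = m ∧ A '' Λ ⊆ (fun q => L q + s₁) '' Brl σ ∧ B '' Λ ⊆ (fun q => L q + s₂) '' Brl σ';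
    let CoAx : (EuclideanSpace ℝ (Fin 3) ≃ₗᵢ[ℝ] EuclideanSpace ℝ (Fin 3)) → (EuclideanSpace ℝ (Fin 3) ≃ₗᵢ[ℝ] EuclideanSpace ℝ (Fin 3)) → Prop := fun A B => ∃ m, Ax m A B;
    let Per : Set (EuclideanSpace ℝ (Fin 3)) → Set (EuclideanSpace ℝ (Fin 3)) → ℝ := fun K S => (⨆ (ξ : EuclideanSpace ℝ (Fin 3) → EuclideanSpace ℝ (Fin 3)) (_ : ContDiff ℝ 1 ξ ∧ HasCompactSupport ξ ∧ ∀ z, ξ z ∈ K), ENNReal.ofReal (∫ z in S, Literature.MathematicalPhysics.StatisticalMechanics.fieldDivergence ξ z)).toReal;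
    let ι : Set (EuclideanSpace ℝ (Fin 3)) → Set (EuclideanSpace ℝ (Fin 3)) → Set (EuclideanSpace ℝ (Fin 3)) → ℝ := fun K S₁ S₂ => (Per K S₁ + Per K S₂ - Per K (S₁ ∪ S₂)) / 2;
    let Dsc : EuclideanSpace ℝ (Fin 3) → Set (EuclideanSpace ℝ (Fin 3)) := fun m => {y | ‖y‖ ≤ 1 ∧ ⟪y, m⟫_ℝ = 0};
    let Tex : (n : ℕ) → (Fin n → Set (EuclideanSpace ℝ (Fin 3))) → (Fin n → (EuclideanSpace ℝ (Fin 3) ≃ₗᵢ[ℝ] EuclideanSpace ℝ (Fin 3))) → (Fin n → Fin n → ℝ) → (Fin n → Fin n → EuclideanSpace ℝ (Fin 3)) → Prop := fun n G A c m => (∀ f : Fin n, Literature.MathematicalPhysics.StatisticalMechanics.HasFinitePerimeter (G f) ∧ volume (G f) < ⊤) ∧ (∀ f g, f ≠ g → Disjoint (G f) (G g)) ∧ (∀ f g, f ≠ g → 0 ≤ c f g) ∧ (∀ f g, f ≠ g → ¬ CoAx (A f) (A g) → m f g = 0 ∧ 1 ≤ c f g) ∧ (∀ f g, f ≠ g →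 CoAx (A f) (A g) → A f '' Λ ≠ A g '' Λ → Ax (m f g) (A f) (A g) ∧ 1 / 2 ≤ c f g);
    let Poly : Set (EuclideanSpace ℝ (Fin 3)) → Prop := fun S => ∃ (k : ℕ) (H : Fin k → Finset ((EuclideanSpace ℝ (Fin 3)) × ℝ)), S = ⋃ i, ⋂ p ∈ H i, {x | ⟪p.1, x⟫_ℝ < p.2};
    let TF : (n : ℕ) → (Fin n → (EuclideanSpace ℝ (Fin 3) ≃ₗᵢ[ℝ] EuclideanSpace ℝ (Fin 3))) → Prop := fun n A => ∀ f g : Fin n, f ≠ g → CoAx (A f) (A g) → A f '' Λ = A g '' Λ;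
    ∀ (n : ℕ) (G : Fin n → Set (EuclideanSpace ℝ (Fin 3))) (A : Fin n → (EuclideanSpace ℝ (Fin 3) ≃ₗᵢ[ℝ] EuclideanSpace ℝ (Fin 3))) (c : Fin n → Fin n → ℝ) (m : Fin n → Fin n → EuclideanSpace ℝ (Fin 3))
      (β : Type) [DecidableEq β] (cls : Fin n → β),
      Tex n G A c m → (∀ f, Poly (G f)) → TF n A → (∀ f g : Fin n, cls f = cls g ↔ A f '' Λ = A g '' Λ) →
      (∑ f, ∑ g, (if cls f ≠ cls g then ι (Metric.closedBall (0 : EuclideanSpace ℝ (Fin 3)) 1) (G f) (G g) / 2 else 0)) ≤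
        ∑ f, ∑ g, (if f = g then 0 else c f g / 2 * ι (Dsc (m f g)) (G f) (G g)) := by
  intro Λ Brl Ax CoAx Per ι Dsc Tex Poly TF n G A c m β _ cls hTex hPoly hTF hcls
  classical
  obtain ⟨hfin, hdisj, hc0, hgen, -⟩ := hTex
  have hvol : ∀ f, volume (G f) < ⊤ := fun f => (hfin f).2
  have hwall : ∀ f g, cls f ≠ cls g → m f g = 0 ∧ 1 ≤ c f g := by
    intro f g hne
    have hne' : A f '' Λ ≠ A g '' Λ := fun h => hne ((hcls f g).2 h)
    have hfg : f ≠ g := fun h => hne (h ▸ rfl)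
    exact hgen f g hfg (fun hcx => hne' (hTF f g hfg hcx))
  have hDsc0 : Dsc 0 = Metric.closedBall (0 : E3) 1 := by
    show {y : E3 | ‖y‖ ≤ 1 ∧ ⟪y, (0 : E3)⟫_ℝ = 0} = Metric.closedBall 0 1
    ext y; simp [inner_zero_right]
  have hBc : IsCompact (Metric.closedBall (0 : E3) 1) := isCompact_closedBall 0 1
  have hBv : Convex ℝ (Metric.closedBall (0 : E3) 1) := convex_closedBall 0 1
  have hB0 : (0 : E3) ∈ Metric.closedBall (0 : E3) 1 := Metric.mem_closedBall_self zero_le_one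
  have hDc : ∀ v : E3, IsCompact (Dsc v) := fun v =>
    Metric.isCompact_of_isClosed_isBounded
      ((isClosed_le continuous_norm continuous_const).inter
        (isClosed_eq (continuous_id.inner continuous_const) continuous_const))
      (Metric.isBounded_closedBall.subset (cruxDisc_subset_closedBall v))
  refine Finset.sum_le_sum fun f _ => Finset.sum_le_sum fun g _ => ?_
  by_cases hfg : f = g
  · subst hfg; simp
  rw [if_neg hfg]
  have hιD : 0 ≤ ι (Dsc (m f g)) (G f) (G g) := by
    show 0 ≤ (per (Dsc (m f g)) (G f) + per (Dsc (m f g)) (G g) - per (Dsc (m f g)) (G f ∪ G g)) / 2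
    exact div_nonneg (iota_nonneg_of_poly G hPoly hvol hdisj (hDc (m f g)) (convex_cruxDisc (m f g))
      (zero_mem_cruxDisc (m f g)) hfg) zero_le_two
  by_cases hne : cls f ≠ cls g
  · rw [if_pos hne]
    obtain ⟨hm, hc1⟩ := hwall f g hne
    rw [hm, hDsc0]
    have hιB : 0 ≤ ι (Metric.closedBall (0 : E3) 1) (G f) (G g) := by
      show 0 ≤ (per (Metric.closedBall (0 : E3) 1) (G f) + per (Metric.closedBall (0 : E3) 1) (G g) -
        per (Metric.closedBall (0 : E3) 1) (G f ∪ G g)) / 2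
      exact div_nonneg (iota_nonneg_of_poly G hPoly hvol hdisj hBc hBv hB0 hfg) zero_le_two
    nlinarith
  · rw [if_neg hne]
    exact mul_nonneg (div_nonneg (hc0 f g hfg) zero_le_two) hιD

/-- The crux's energy splits as `En = Σ_f Fr_f + walls` (pure bookkeeping, any data). -/
theorem en_eq_freeEnergy_add_walls {n : ℕ} (P : Fin n → ℝ) (I Wl : Fin n → Fin n → ℝ) :
    (∑ f, P f) - (∑ f, ∑ g, I f g) + (∑ f, ∑ g, Wl f g) =
      (∑ f, (P f - ∑ g, I f g)) + ∑ f, ∑ g, Wl f g := by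
  rw [Finset.sum_sub_distrib]

end Summit.Ventures.Crystal3D.Cruxes.PolycrystalWulffBound.PolyDensity

end
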